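import Summits.CriticalPhenomena.PercolationContinuityZ3.Theorems.PercNearOneGluingNoHeavyLowerTailSahiCombMixCoord

/-!
# The comb (tensor-Bernstein) hierarchy for Sahi's `E_k`, XXXVIII: the generic FOUR-slot OR-mixture cell on the cube (for the singleton four-slot cells of comb H-MIX(4))

Support file of the one-cut programme (crux `NoHeavyLowerTail`, stmt-CriticalPhenomena-4575; cell `prim-masterthm`, seat P3, gen 8; HIERARCHY.md §15(d)).  Cube version of
`SahiMixture.sahiE_four_mixEv_eq` (gen 7, `…SahiMixtureFourSlotCell`): for `P_j ⊆ Q_j` ignoring `e`,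
`E_4(μ_p; mixCoord e P_j Q_j) = (1−p_e)⁴E_4(P) + p_e(1−p_e)³·mix4C1 + p_e²(1−p_e)²·mix4C2 + p_e³(1−p_e)·mix4C3 + p_e⁴E_4(Q)` with `mix4C1/2/3` the SAME moment
polynomials (51/72/51 terms) as at law level (`sahiE_four_mixCoord_eq`), and **`combPos_four_mixCoord_of_coeffs`**: comb positivity of the five coefficients off `e` gives
comb positivity of the cell at multidegree `4`.  The interface `SahiCombMix.CombFourSingletonCells` of `…SahiCombMixFour` is the case `P_j = U_j`, `Q_j ∈ {U_j, Ω}`.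
[this work]
-/

noncomputable section

open scoped Classical

namespace Summit.CriticalPhenomena.PercolationContinuityZ3.Theorems

open Finset Function
open Literature.Combinatorics.Sahi2008
open Literature.Probability.Percolation.BHK2006 (ind_inter)
open Literature.Probability.Percolation.DecisionTree (ind ind_of_mem ind_of_not_mem ind_nonneg)
open SahiComb

variable {ι : Type} [Fintype ι]

namespace SahiCombMix

section Four

variable (μ : Set ι → ℝ) (P Q : Fin 4 → Set (Set ι))

/-- The coefficient `C_1` of the generic four-slot OR-mixture cell (same polynomial as in `SahiMixture.sahiE_four_mixEv_eq`). [this work] -/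
def mix4C1 : ℝ := 18 * ex μ (ind (P 0) * ind (P 1) * ind (P 2) * ind (P 3)) + 6 * ex μ (ind (Q 0) * ind (Q 1) * ind (Q 2) * ind (Q 3)) - 4 * ex μ (ind (P 0)) * ex μ (ind (P 1) * ind (P 2) * ind (P 3)) - 2 * ex μ (ind (P 0)) * ex μ (ind (Q 1) * ind (Q 2) * ind (Q 3)) - 2 * ex μ (ind (P 0) * ind (P 1)) * ex μ (ind (P 2) * ind (P 3)) - ex μ (ind (P 0) * ind (P 1)) * ex μ (ind (Q 2) * ind (Q 3)) - 4 * ex μ (ind (P 0) * ind (P 1) * ind (P 2)) * ex μ (ind (P 3)) - 2 * ex μ (ind (P 0) * ind (P 1) * ind (P 2)) * ex μ (ind (Q 3)) - 4 * ex μ (ind (P 0) * ind (P 1) * ind (P 3)) * ex μ (ind (P 2)) - 2 * ex μ (ind (P 0) * ind (P 1) * ind (P 3)) * ex μ (ind (Q 2)) - 2 * ex μ (ind (P 0) * ind (P 2)) * ex μ (ind (P 1) * ind (P 3)) - ex μ (ind (P 0) * ind (P 2)) * ex μ (ind (Q 1) * ind (Q 3)) - 4 * ex μ (ind (P 0) *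 ind (P 2) * ind (P 3)) * ex μ (ind (P 1)) - 2 * ex μ (ind (P 0) * ind (P 2) * ind (P 3)) * ex μ (ind (Q 1)) - 2 * ex μ (ind (P 0) * ind (P 3)) * ex μ (ind (P 1) * ind (P 2)) - ex μ (ind (P 0) * ind (P 3)) * ex μ (ind (Q 1) * ind (Q 2)) - 2 * ex μ (ind (P 1)) * ex μ (ind (Q 0) * ind (Q 2) * ind (Q 3)) - ex μ (ind (P 1) * ind (P 2)) * ex μ (ind (Q 0) * ind (Q 3)) - 2 * ex μ (ind (P 1) * ind (P 2) * ind (P 3)) * ex μ (ind (Q 0)) - ex μ (ind (P 1) * ind (P 3)) * ex μ (ind (Q 0) * ind (Q 2)) - 2 * ex μ (ind (P 2)) * ex μ (ind (Q 0) * ind (Q 1) * ind (Q 3)) - ex μ (ind (P 2) * ind (P 3)) * ex μ (ind (Q 0) * ind (Q 1)) - 2 * ex μ (ind (P 3)) * ex μ (ind (Q 0) * ind (Q 1) * ind (Q 2)) + ex μ (ind (P 0)) * ex μ (ind (P 1)) * ex μ (ind (P 2) * ind (P 3)) + ex μ (ind (P 0)) * ex μ (ind (P 1)) * ex μ (ind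 (Q 2) * ind (Q 3)) + ex μ (ind (P 0)) * ex μ (ind (P 1) * ind (P 2)) * ex μ (ind (P 3)) + ex μ (ind (P 0)) * ex μ (ind (P 1) * ind (P 2)) * ex μ (ind (Q 3)) + ex μ (ind (P 0)) * ex μ (ind (P 1) * ind (P 3)) * ex μ (ind (P 2)) + ex μ (ind (P 0)) * ex μ (ind (P 1) * ind (P 3)) * ex μ (ind (Q 2)) + ex μ (ind (P 0)) * ex μ (ind (P 2)) * ex μ (ind (Q 1) * ind (Q 3)) + ex μ (ind (P 0)) * ex μ (ind (P 2) * ind (P 3)) * ex μ (ind (Q 1)) + ex μ (ind (P 0)) * ex μ (ind (P 3)) * ex μ (ind (Q 1) * ind (Q 2)) + ex μ (ind (P 0) * ind (P 1)) * ex μ (ind (P 2)) * ex μ (ind (P 3)) + ex μ (ind (P 0) * ind (P 1)) * ex μ (ind (P 2)) * ex μ (ind (Q 3)) + ex μ (ind (P 0) * ind (P 1)) * ex μ (ind (P 3)) * ex μ (ind (Q 2)) + ex μ (ind (P 0) * ind (P 2)) * ex μ (ind (P 1)) * ex μ (ind (P 3)) + ex μ (ind (P 0) * ind (P 2)) * ex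 μ (ind (P 1)) * ex μ (ind (Q 3)) + ex μ (ind (P 0) * ind (P 2)) * ex μ (ind (P 3)) * ex μ (ind (Q 1)) + ex μ (ind (P 0) * ind (P 3)) * ex μ (ind (P 1)) * ex μ (ind (P 2)) + ex μ (ind (P 0) * ind (P 3)) * ex μ (ind (P 1)) * ex μ (ind (Q 2)) + ex μ (ind (P 0) * ind (P 3)) * ex μ (ind (P 2)) * ex μ (ind (Q 1)) + ex μ (ind (P 1)) * ex μ (ind (P 2)) * ex μ (ind (Q 0) * ind (Q 3)) + ex μ (ind (P 1)) * ex μ (ind (P 2) * ind (P 3)) * ex μ (ind (Q 0)) + ex μ (ind (P 1)) * ex μ (ind (P 3)) * ex μ (ind (Q 0) * ind (Q 2)) + ex μ (ind (P 1) * ind (P 2)) * ex μ (ind (P 3)) * ex μ (ind (Q 0)) + ex μ (ind (P 1) * ind (P 3)) * ex μ (ind (P 2)) * ex μ (ind (Q 0)) + ex μ (ind (P 2)) * ex μ (ind (P 3)) * ex μ (ind (Q 0) * ind (Q 1)) - ex μ (ind (P 0)) * ex μ (ind (P 1)) * ex μ (ind (P 2)) * ex μ (ind (Q 3)) - ex μ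 (ind (P 0)) * ex μ (ind (P 1)) * ex μ (ind (P 3)) * ex μ (ind (Q 2)) - ex μ (ind (P 0)) * ex μ (ind (P 2)) * ex μ (ind (P 3)) * ex μ (ind (Q 1)) - ex μ (ind (P 1)) * ex μ (ind (P 2)) * ex μ (ind (P 3)) * ex μ (ind (Q 0))

/-- The coefficient `C_2` of the generic four-slot OR-mixture cell. [this work] -/
def mix4C2 : ℝ := 18 * ex μ (ind (P 0) * ind (P 1) * ind (P 2) * ind (P 3)) + 18 * ex μ (ind (Q 0) * ind (Q 1) * ind (Q 2) * ind (Q 3)) - 2 * ex μ (ind (P 0)) * ex μ (ind (P 1) * ind (P 2) * ind (P 3)) - 4 * ex μ (ind (P 0)) * ex μ (ind (Q 1) * ind (Q 2) * ind (Q 3)) - ex μ (ind (P 0) * ind (P 1)) * ex μ (ind (P 2) * ind (P 3)) - 2 * ex μ (ind (P 0) * ind (P 1)) * ex μ (ind (Q 2) * ind (Q 3)) - 2 * ex μ (ind (P 0) * ind (P 1) * ind (P 2)) * ex μ (ind (P 3)) - 4 * ex μ (ind (P 0) * ind (P 1) * ind (P 2)) * ex μ (ind (Q 3)) - 2 * ex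 μ (ind (P 0) * ind (P 1) * ind (P 3)) * ex μ (ind (P 2)) - 4 * ex μ (ind (P 0) * ind (P 1) * ind (P 3)) * ex μ (ind (Q 2)) - ex μ (ind (P 0) * ind (P 2)) * ex μ (ind (P 1) * ind (P 3)) - 2 * ex μ (ind (P 0) * ind (P 2)) * ex μ (ind (Q 1) * ind (Q 3)) - 2 * ex μ (ind (P 0) * ind (P 2) * ind (P 3)) * ex μ (ind (P 1)) - 4 * ex μ (ind (P 0) * ind (P 2) * ind (P 3)) * ex μ (ind (Q 1)) - ex μ (ind (P 0) * ind (P 3)) * ex μ (ind (P 1) * ind (P 2)) - 2 * ex μ (ind (P 0) * ind (P 3)) * ex μ (ind (Q 1) * ind (Q 2)) - 4 * ex μ (ind (P 1)) * ex μ (ind (Q 0) * ind (Q 2) * ind (Q 3)) - 2 * ex μ (ind (P 1) * ind (P 2)) * ex μ (ind (Q 0) * ind (Q 3)) - 4 * ex μ (ind (P 1) * ind (P 2) * ind (P 3)) * ex μ (ind (Q 0)) - 2 * ex μ (ind (P 1) * ind (P 3)) * ex μ (ind (Q 0) * ind (Q 2)) - 4 * ex μ (ind (P 2)) * ex μ (ind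 (Q 0) * ind (Q 1) * ind (Q 3)) - 2 * ex μ (ind (P 2) * ind (P 3)) * ex μ (ind (Q 0) * ind (Q 1)) - 4 * ex μ (ind (P 3)) * ex μ (ind (Q 0) * ind (Q 1) * ind (Q 2)) - 2 * ex μ (ind (Q 0)) * ex μ (ind (Q 1) * ind (Q 2) * ind (Q 3)) - ex μ (ind (Q 0) * ind (Q 1)) * ex μ (ind (Q 2) * ind (Q 3)) - 2 * ex μ (ind (Q 0) * ind (Q 1) * ind (Q 2)) * ex μ (ind (Q 3)) - 2 * ex μ (ind (Q 0) * ind (Q 1) * ind (Q 3)) * ex μ (ind (Q 2)) - ex μ (ind (Q 0) * ind (Q 2)) * ex μ (ind (Q 1) * ind (Q 3)) - 2 * ex μ (ind (Q 0) * ind (Q 2) * ind (Q 3)) * ex μ (ind (Q 1)) - ex μ (ind (Q 0) * ind (Q 3)) * ex μ (ind (Q 1) * ind (Q 2)) + ex μ (ind (P 0)) * ex μ (ind (P 1)) * ex μ (ind (Q 2) * ind (Q 3)) + ex μ (ind (P 0)) * ex μ (ind (P 1) * ind (P 2)) * ex μ (ind (Q 3)) + ex μ (ind (P 0)) * ex μ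 (ind (P 1) * ind (P 3)) * ex μ (ind (Q 2)) + ex μ (ind (P 0)) * ex μ (ind (P 2)) * ex μ (ind (Q 1) * ind (Q 3)) + ex μ (ind (P 0)) * ex μ (ind (P 2) * ind (P 3)) * ex μ (ind (Q 1)) + ex μ (ind (P 0)) * ex μ (ind (P 3)) * ex μ (ind (Q 1) * ind (Q 2)) + ex μ (ind (P 0)) * ex μ (ind (Q 1)) * ex μ (ind (Q 2) * ind (Q 3)) + ex μ (ind (P 0)) * ex μ (ind (Q 1) * ind (Q 2)) * ex μ (ind (Q 3)) + ex μ (ind (P 0)) * ex μ (ind (Q 1) * ind (Q 3)) * ex μ (ind (Q 2)) + ex μ (ind (P 0) * ind (P 1)) * ex μ (ind (P 2)) * ex μ (ind (Q 3)) + ex μ (ind (P 0) * ind (P 1)) * ex μ (ind (P 3)) * ex μ (ind (Q 2)) + ex μ (ind (P 0) * ind (P 1)) * ex μ (ind (Q 2)) * ex μ (ind (Q 3)) + ex μ (ind (P 0) * ind (P 2)) * ex μ (ind (P 1)) * ex μ (ind (Q 3)) + ex μ (ind (P 0) * ind (P 2)) * ex μ (ind (P 3)) * ex μ (ind (Q 1))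 + ex μ (ind (P 0) * ind (P 2)) * ex μ (ind (Q 1)) * ex μ (ind (Q 3)) + ex μ (ind (P 0) * ind (P 3)) * ex μ (ind (P 1)) * ex μ (ind (Q 2)) + ex μ (ind (P 0) * ind (P 3)) * ex μ (ind (P 2)) * ex μ (ind (Q 1)) + ex μ (ind (P 0) * ind (P 3)) * ex μ (ind (Q 1)) * ex μ (ind (Q 2)) + ex μ (ind (P 1)) * ex μ (ind (P 2)) * ex μ (ind (Q 0) * ind (Q 3)) + ex μ (ind (P 1)) * ex μ (ind (P 2) * ind (P 3)) * ex μ (ind (Q 0)) + ex μ (ind (P 1)) * ex μ (ind (P 3)) * ex μ (ind (Q 0) * ind (Q 2)) + ex μ (ind (P 1)) * ex μ (ind (Q 0)) * ex μ (ind (Q 2) * ind (Q 3)) + ex μ (ind (P 1)) * ex μ (ind (Q 0) * ind (Q 2)) * ex μ (ind (Q 3)) + ex μ (ind (P 1)) * ex μ (ind (Q 0) * ind (Q 3)) * ex μ (ind (Q 2)) + ex μ (ind (P 1) * ind (P 2)) * ex μ (ind (P 3)) * ex μ (ind (Q 0)) + ex μ (ind (P 1) * ind (P 2)) * ex μ (ind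 (Q 0)) * ex μ (ind (Q 3)) + ex μ (ind (P 1) * ind (P 3)) * ex μ (ind (P 2)) * ex μ (ind (Q 0)) + ex μ (ind (P 1) * ind (P 3)) * ex μ (ind (Q 0)) * ex μ (ind (Q 2)) + ex μ (ind (P 2)) * ex μ (ind (P 3)) * ex μ (ind (Q 0) * ind (Q 1)) + ex μ (ind (P 2)) * ex μ (ind (Q 0)) * ex μ (ind (Q 1) * ind (Q 3)) + ex μ (ind (P 2)) * ex μ (ind (Q 0) * ind (Q 1)) * ex μ (ind (Q 3)) + ex μ (ind (P 2)) * ex μ (ind (Q 0) * ind (Q 3)) * ex μ (ind (Q 1)) + ex μ (ind (P 2) * ind (P 3)) * ex μ (ind (Q 0)) * ex μ (ind (Q 1)) + ex μ (ind (P 3)) * ex μ (ind (Q 0)) * ex μ (ind (Q 1) * ind (Q 2)) + ex μ (ind (P 3)) * ex μ (ind (Q 0) * ind (Q 1)) * ex μ (ind (Q 2)) + ex μ (ind (P 3)) * ex μ (ind (Q 0) * ind (Q 2)) * ex μ (ind (Q 1)) - ex μ (ind (P 0)) * ex μ (ind (P 1)) * ex μ (ind (Q 2)) * ex μ (ind (Q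 3)) - ex μ (ind (P 0)) * ex μ (ind (P 2)) * ex μ (ind (Q 1)) * ex μ (ind (Q 3)) - ex μ (ind (P 0)) * ex μ (ind (P 3)) * ex μ (ind (Q 1)) * ex μ (ind (Q 2)) - ex μ (ind (P 1)) * ex μ (ind (P 2)) * ex μ (ind (Q 0)) * ex μ (ind (Q 3)) - ex μ (ind (P 1)) * ex μ (ind (P 3)) * ex μ (ind (Q 0)) * ex μ (ind (Q 2)) - ex μ (ind (P 2)) * ex μ (ind (P 3)) * ex μ (ind (Q 0)) * ex μ (ind (Q 1))

/-- The coefficient `C_3` of the generic four-slot OR-mixture cell. [this work] -/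
def mix4C3 : ℝ := 6 * ex μ (ind (P 0) * ind (P 1) * ind (P 2) * ind (P 3)) + 18 * ex μ (ind (Q 0) * ind (Q 1) * ind (Q 2) * ind (Q 3)) - 2 * ex μ (ind (P 0)) * ex μ (ind (Q 1) * ind (Q 2) * ind (Q 3)) - ex μ (ind (P 0) * ind (P 1)) * ex μ (ind (Q 2) * ind (Q 3)) - 2 * ex μ (ind (P 0) * ind (P 1) * ind (P 2)) * ex μ (ind (Q 3)) - 2 * ex μ (ind (P 0) * ind (P 1) * ind (P 3)) * ex μ (ind (Q 2)) - ex μ (ind (P 0) * ind (P 2)) * ex μ (ind (Q 1) * ind (Q 3)) - 2 * ex μ (ind (P 0) * ind (P 2) * ind (P 3)) * ex μ (ind (Q 1)) - ex μ (ind (P 0) * ind (P 3)) * ex μ (ind (Q 1) * ind (Q 2)) - 2 * ex μ (ind (P 1)) * ex μ (ind (Q 0) * ind (Q 2) * ind (Q 3)) - ex μ (ind (P 1) * ind (P 2)) * ex μ (ind (Q 0) * ind (Q 3)) - 2 * ex μ (ind (P 1) * ind (P 2) * ind (P 3)) * ex μ (ind (Q 0)) - ex μ (ind (P 1) * ind (P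 3)) * ex μ (ind (Q 0) * ind (Q 2)) - 2 * ex μ (ind (P 2)) * ex μ (ind (Q 0) * ind (Q 1) * ind (Q 3)) - ex μ (ind (P 2) * ind (P 3)) * ex μ (ind (Q 0) * ind (Q 1)) - 2 * ex μ (ind (P 3)) * ex μ (ind (Q 0) * ind (Q 1) * ind (Q 2)) - 4 * ex μ (ind (Q 0)) * ex μ (ind (Q 1) * ind (Q 2) * ind (Q 3)) - 2 * ex μ (ind (Q 0) * ind (Q 1)) * ex μ (ind (Q 2) * ind (Q 3)) - 4 * ex μ (ind (Q 0) * ind (Q 1) * ind (Q 2)) * ex μ (ind (Q 3)) - 4 * ex μ (ind (Q 0) * ind (Q 1) * ind (Q 3)) * ex μ (ind (Q 2)) - 2 * ex μ (ind (Q 0) * ind (Q 2)) * ex μ (ind (Q 1) * ind (Q 3)) - 4 * ex μ (ind (Q 0) * ind (Q 2) * ind (Q 3)) * ex μ (ind (Q 1)) - 2 * ex μ (ind (Q 0) * ind (Q 3)) * ex μ (ind (Q 1) * ind (Q 2)) + ex μ (ind (P 0)) * ex μ (ind (Q 1)) * ex μ (ind (Q 2) * ind (Q 3)) + ex μ (ind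 (P 0)) * ex μ (ind (Q 1) * ind (Q 2)) * ex μ (ind (Q 3)) + ex μ (ind (P 0)) * ex μ (ind (Q 1) * ind (Q 3)) * ex μ (ind (Q 2)) + ex μ (ind (P 0) * ind (P 1)) * ex μ (ind (Q 2)) * ex μ (ind (Q 3)) + ex μ (ind (P 0) * ind (P 2)) * ex μ (ind (Q 1)) * ex μ (ind (Q 3)) + ex μ (ind (P 0) * ind (P 3)) * ex μ (ind (Q 1)) * ex μ (ind (Q 2)) + ex μ (ind (P 1)) * ex μ (ind (Q 0)) * ex μ (ind (Q 2) * ind (Q 3)) + ex μ (ind (P 1)) * ex μ (ind (Q 0) * ind (Q 2)) * ex μ (ind (Q 3)) + ex μ (ind (P 1)) * ex μ (ind (Q 0) * ind (Q 3)) * ex μ (ind (Q 2)) + ex μ (ind (P 1) * ind (P 2)) * ex μ (ind (Q 0)) * ex μ (ind (Q 3)) + ex μ (ind (P 1) * ind (P 3)) * ex μ (ind (Q 0)) * ex μ (ind (Q 2)) + ex μ (ind (P 2)) * ex μ (ind (Q 0)) * ex μ (ind (Q 1) * ind (Q 3)) + ex μ (ind (P 2)) * ex μ (ind (Q 0) *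 ind (Q 1)) * ex μ (ind (Q 3)) + ex μ (ind (P 2)) * ex μ (ind (Q 0) * ind (Q 3)) * ex μ (ind (Q 1)) + ex μ (ind (P 2) * ind (P 3)) * ex μ (ind (Q 0)) * ex μ (ind (Q 1)) + ex μ (ind (P 3)) * ex μ (ind (Q 0)) * ex μ (ind (Q 1) * ind (Q 2)) + ex μ (ind (P 3)) * ex μ (ind (Q 0) * ind (Q 1)) * ex μ (ind (Q 2)) + ex μ (ind (P 3)) * ex μ (ind (Q 0) * ind (Q 2)) * ex μ (ind (Q 1)) + ex μ (ind (Q 0)) * ex μ (ind (Q 1)) * ex μ (ind (Q 2) * ind (Q 3)) + ex μ (ind (Q 0)) * ex μ (ind (Q 1) * ind (Q 2)) * ex μ (ind (Q 3)) + ex μ (ind (Q 0)) * ex μ (ind (Q 1) * ind (Q 3)) * ex μ (ind (Q 2)) + ex μ (ind (Q 0) * ind (Q 1)) * ex μ (ind (Q 2)) * ex μ (ind (Q 3)) + ex μ (ind (Q 0) * ind (Q 2)) * ex μ (ind (Q 1)) * ex μ (ind (Q 3)) + ex μ (ind (Q 0) * ind (Q 3)) * ex μ (ind (Q 1)) * ex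 μ (ind (Q 2)) - ex μ (ind (P 0)) * ex μ (ind (Q 1)) * ex μ (ind (Q 2)) * ex μ (ind (Q 3)) - ex μ (ind (P 1)) * ex μ (ind (Q 0)) * ex μ (ind (Q 2)) * ex μ (ind (Q 3)) - ex μ (ind (P 2)) * ex μ (ind (Q 0)) * ex μ (ind (Q 1)) * ex μ (ind (Q 3)) - ex μ (ind (P 3)) * ex μ (ind (Q 0)) * ex μ (ind (Q 1)) * ex μ (ind (Q 2))

end Four

section Cell

variable (e : ι) (P Q : Fin 4 → Set (Set ι)) (hP : ∀ (j : Fin 4) (b : Bool), secAt e b (P j) = P j)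
  (hQ : ∀ (j : Fin 4) (b : Bool), secAt e b (Q j) = Q j) (hPQ : ∀ j, P j ⊆ Q j)
include hP hQ hPQ

/-- Block moments of two, three and four mixed slots. [this work] -/
theorem ex_ind_mixCoord_prod (p : ι → unitInterval) :
    (∀ i j : Fin 4, ex (bernoulliWeight p) (ind (mixCoord e (P i) (Q i)) * ind (mixCoord e (P j) (Q j)))
      = (1 - (p e : ℝ)) * ex (bernoulliWeight p) (ind (P i) * ind (P j)) + (p e : ℝ) * ex (bernoulliWeight p) (ind (Q i) * ind (Q j))) ∧
    (∀ i j k : Fin 4, ex (bernoulliWeight p) (ind (mixCoord e (P i) (Q i)) * ind (mixCoord e (P j) (Q j)) * ind (mixCoord e (P k) (Q k)))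
      = (1 - (p e : ℝ)) * ex (bernoulliWeight p) (ind (P i) * ind (P j) * ind (P k)) + (p e : ℝ) * ex (bernoulliWeight p) (ind (Q i) * ind (Q j) * ind (Q k))) ∧
    (ex (bernoulliWeight p) (ind (mixCoord e (P 0) (Q 0)) * ind (mixCoord e (P 1) (Q 1)) * ind (mixCoord e (P 2) (Q 2)) * ind (mixCoord e (P 3) (Q 3)))
      = (1 - (p e : ℝ)) * ex (bernoulliWeight p) (ind (P 0) * ind (P 1) * ind (P 2) * ind (P 3))
        + (p e : ℝ) * ex (bernoulliWeight p) (ind (Q 0) * ind (Q 1) * ind (Q 2) * ind (Q 3))) := by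
  have sP2 : ∀ (i j : Fin 4) (b : Bool), secAt e b (P i ∩ P j) = P i ∩ P j := fun i j b => by rw [secAt_inter, hP, hP]
  have sQ2 : ∀ (i j : Fin 4) (b : Bool), secAt e b (Q i ∩ Q j) = Q i ∩ Q j := fun i j b => by rw [secAt_inter, hQ, hQ]
  have sP3 : ∀ (i j k : Fin 4) (b : Bool), secAt e b (P i ∩ P j ∩ P k) = P i ∩ P j ∩ P k := fun i j k b => by rw [secAt_inter, sP2, hP]
  have sQ3 : ∀ (i j k : Fin 4) (b : Bool), secAt e b (Q i ∩ Q j ∩ Q k) = Q i ∩ Q j ∩ Q k := fun i j k b => by rw [secAt_inter, sQ2, hQ]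
  have sP4 : ∀ b : Bool, secAt e b (P 0 ∩ P 1 ∩ P 2 ∩ P 3) = P 0 ∩ P 1 ∩ P 2 ∩ P 3 := fun b => by rw [secAt_inter, sP3, hP]
  have sQ4 : ∀ b : Bool, secAt e b (Q 0 ∩ Q 1 ∩ Q 2 ∩ Q 3) = Q 0 ∩ Q 1 ∩ Q 2 ∩ Q 3 := fun b => by rw [secAt_inter, sQ3, hQ]
  have u2 : ∀ i j : Fin 4, P i ∩ P j ⊆ Q i ∩ Q j := fun i j => Set.inter_subset_inter (hPQ i) (hPQ j)
  have u3 : ∀ i j k : Fin 4, P i ∩ P j ∩ P k ⊆ Q i ∩ Q j ∩ Q k := fun i j k => Set.inter_subset_inter (u2 i j) (hPQ k)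
  refine ⟨fun i j => ?_, fun i j k => ?_, ?_⟩
  · rw [ind_mixCoord_mul e (hPQ i) (hPQ j), ex_ind_mixCoord e (sP2 i j) (sQ2 i j) (u2 i j) p]
    congr 2 <;> (congr 1; funext ω; exact ind_inter _ _ ω)
  · rw [ind_mixCoord_mul e (hPQ i) (hPQ j), ind_mixCoord_mul e (u2 i j) (hPQ k), ex_ind_mixCoord e (sP3 i j k) (sQ3 i j k) (u3 i j k) p]
    congr 2 <;> (congr 1; funext ω; rw [Pi.mul_apply, Pi.mul_apply, ind_inter, ind_inter])
  · rw [ind_mixCoord_mul e (hPQ 0) (hPQ 1), ind_mixCoord_mul e (u2 0 1) (hPQ 2), ind_mixCoord_mul e (u3 0 1 2) (hPQ 3),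
      ex_ind_mixCoord e sP4 sQ4 (Set.inter_subset_inter (u3 0 1 2) (hPQ 3)) p]
    congr 2 <;> (congr 1; funext ω; rw [Pi.mul_apply, Pi.mul_apply, Pi.mul_apply, ind_inter, ind_inter, ind_inter])

/-- **THE GENERIC FOUR-SLOT CELL ON THE CUBE** in Bernstein form along `p_e`. [this work] -/
theorem sahiE_four_mixCoord_eq (p : ι → unitInterval) :
    sahiE (bernoulliWeight p) 4 (fun j => ind (mixCoord e (P j) (Q j)))
      = (1 - (p e : ℝ)) ^ 4 * sahiE (bernoulliWeight p) 4 (fun j => ind (P j))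
        + (p e : ℝ) * (1 - (p e : ℝ)) ^ 3 * mix4C1 (bernoulliWeight p) P Q
        + (p e : ℝ) ^ 2 * (1 - (p e : ℝ)) ^ 2 * mix4C2 (bernoulliWeight p) P Q
        + (p e : ℝ) ^ 3 * (1 - (p e : ℝ)) * mix4C3 (bernoulliWeight p) P Q
        + (p e : ℝ) ^ 4 * sahiE (bernoulliWeight p) 4 (fun j => ind (Q j)) := by
  obtain ⟨m2, m3, m4⟩ := ex_ind_mixCoord_prod e P Q hP hQ hPQ p
  have m1 : ∀ j : Fin 4, ex (bernoulliWeight p) (ind (mixCoord e (P j) (Q j)))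
      = (1 - (p e : ℝ)) * ex (bernoulliWeight p) (ind (P j)) + (p e : ℝ) * ex (bernoulliWeight p) (ind (Q j)) :=
    fun j => ex_ind_mixCoord e (hP j) (hQ j) (hPQ j) p
  have eM : (fun j => ind (mixCoord e (P j) (Q j))) = ![ind (mixCoord e (P 0) (Q 0)), ind (mixCoord e (P 1) (Q 1)), ind (mixCoord e (P 2) (Q 2)),
      ind (mixCoord e (P 3) (Q 3))] := by funext j; fin_cases j <;> rfl
  have eP : (fun j => ind (P j)) = ![ind (P 0), ind (P 1), ind (P 2), ind (P 3)] := by funext j; fin_cases j <;> rfl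
  have eQ : (fun j => ind (Q j)) = ![ind (Q 0), ind (Q 1), ind (Q 2), ind (Q 3)] := by funext j; fin_cases j <;> rfl
  rw [eM, eP, eQ, sahiE_four, sahiE_four, sahiE_four]
  simp only [m1, m2, m3, m4, mix4C1, mix4C2, mix4C3]
  ring

/-- **Comb positivity of the four-slot cell from its coefficients** off `e`. [this work] -/
theorem combPos_four_mixCoord_of_coeffs
    (h0 : CombPos (update (fun _ : ι => 4) e 0) (fun p => sahiE (bernoulliWeight p) 4 (fun j => ind (P j))))
    (h1 : CombPos (update (fun _ : ι => 4) e 0) (fun p => mix4C1 (bernoulliWeight p) P Q))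
    (h2 : CombPos (update (fun _ : ι => 4) e 0) (fun p => mix4C2 (bernoulliWeight p) P Q))
    (h3 : CombPos (update (fun _ : ι => 4) e 0) (fun p => mix4C3 (bernoulliWeight p) P Q))
    (h4 : CombPos (update (fun _ : ι => 4) e 0) (fun p => sahiE (bernoulliWeight p) 4 (fun j => ind (Q j)))) :
    CombPos (fun _ : ι => 4) (fun p => sahiE (bernoulliWeight p) 4 (fun j => ind (mixCoord e (P j) (Q j)))) := by
  have d : (Pi.single e 4 + update (fun _ : ι => 4) e 0) ≤ fun _ : ι => 4 := fun x => by
    by_cases hx : x = e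
    · subst hx; simp
    · simp [hx]
  have t0 := (SahiCombDisjunct.combPos_coord_pow e 0 4).mul_of_le h0 d
  have t1 := (SahiCombDisjunct.combPos_coord_pow e 1 3).mul_of_le h1 d
  have t2 := (SahiCombDisjunct.combPos_coord_pow e 2 2).mul_of_le h2 d
  have t3 := (SahiCombDisjunct.combPos_coord_pow e 3 1).mul_of_le h3 d
  have t4 := (SahiCombDisjunct.combPos_coord_pow e 4 0).mul_of_le h4 d
  refine ((((t0.add t1).add t2).add t3).add t4).congr fun p => ?_
  rw [sahiE_four_mixCoord_eq e P Q hP hQ hPQ p]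
  ring

end Cell

end SahiCombMix

end Summit.CriticalPhenomena.PercolationContinuityZ3.Theorems

end
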